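import Literature.IUT.LogThetaLattice.LatticeDiagramOfKitsTaggedToy
import Literature.IUT.LogThetaLattice.FrobeniusChainCoricOfKits
import HarnessLib

/-!
# [IUTchIII] Prop 1.2 (x) — the «Frobenius-picture chain of distinct `ℱ`-prime-strips» row DECIDED POSITIVELY at the TAGGED toy kit
# frame `KitsTaggedToy.frame` (second `StripFrame.ofKits` instance in the tree)

Mochizuki, *Inter-universal Teichmüller Theory III*, kurims manuscript (May 2020), Prop 1.2 (x) p. 34 ("a collection of distinct
`F`-prime-strips … indexed by the integers"), Def 1.4 p. 45; *I* (May 2020) Def 5.2 (i) p. 134. PROOF-ONLY companion (no `def`,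
no `instance`) of this seat's `LatticeDiagramOfKitsTaggedToy.lean` (abc-iut-w5-d043; L6 NV row «NV-W2 IUTchIII:Def1.4») reading
abc-iut-w5-d005's criterion `FrobeniusChain.nonempty_ofKits_iff` (`FrobeniusChainCoricOfKits.lean`: chain iff `Infinite FK.FStrip`) at the
tagged toy kit `FKit.toyTagged l hl` — the criterion had been DECIDED NEGATIVELY at abc-iut-L5-t4's toy kit, the only other
`StripFrame.ofKits` instance (`KitsToy.isEmpty_frobeniusChain`).

* § 1 the tagged kit has INFINITELY MANY `ℱ`-prime-strips (`fStrip_injective`, `infinite_fStrip`; at the one place the model `loc`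
  has the infinitely many isomorphs `(p, loc)`, `infinite_isomorphs`);
* § 2 hence **[IUTchIII] Prop 1.2 (x) POSITIVE at `KitsTaggedToy.frame`**: `nonempty_frobeniusChain`, and the chain's full log-links
  (for the tagged `LogKit`) induce the full `𝒟`-poly-isomorphisms with nonempty core (`frobeniusChain_link_instantiated`) — the FIRST
  `StripFrame.ofKits` instance carrying a Frobenius-picture chain; `frobeniusChain_toy_vs_tagged`; `lattice_and_frobeniusChain` (Def 1.4's
  lattice and Prop 1.2 (x)'s chain at the same kit frame).
NOT HERE: [IUTchII] Cor 4.10 (vi)'s chain of theaters through their `ℱ^⊩`-prime-strips (abc-iut-w5-d193's criterion needs infinitely many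
`ℱ^⊩`-prime-strips; the `ℱ^⊩`-side of the tagged kit is the toy's) — see this seat's `ℱ^⊩`-tagging sequel.

HONEST LABEL (abc-iut-L6-lead §F v1.19j (1)): tagged copies of ONE toy model; nothing here bears on the real-kit line (abc-iut-L5-t4).
Consistency ≠ endorsement; typed ≠ proved; no side taken on [IUTchIII] Cor 3.12. [claim: Mochizuki2012, status: disputed]
-/

namespace Literature.IUT.LogThetaLattice

open CategoryTheory
open Literature.IUT.HodgeTheaters Literature.IUT.HodgeTheaters.PMBaseKit

namespace KitsTaggedToy

variable (l : ℕ) [Fact l.Prime] (hl : l ≠ 2)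

/-! ### 1. The tagged toy kit has infinitely many `ℱ`-prime-strips -/

/-- **IUTchI:Def5.2(i)** (kurims p.134) The tag-`p` copy of the model `ℱ`-prime-strip has constituent `(p, loc)` at the one place.
[claim: Mochizuki2012, status: disputed] -/
theorem fStrip_obj (p : ℤ × ℤ) (v : (toyKit l hl).V) :
    (Literature.IUT.LogThetaLattice.KitsTaggedToy.fStrip l hl p).obj v = (p, Model.Obj.loc) := rfl

/-- **IUTchI:Def5.2(i)** (kurims p.134) Distinct tags give distinct `ℱ`-prime-strips of the tagged toy kit.
[claim: Mochizuki2012, status: disputed] -/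
theorem fStrip_injective : Function.Injective (Literature.IUT.LogThetaLattice.KitsTaggedToy.fStrip l hl) := by
  intro p q h
  have h' := congrArg (fun F : (FKit.toyTagged l hl).FStrip => (F.obj ()).1) h
  simpa [fStrip_obj] using h'

/-- **IUTchI:Def5.2(i)** (kurims p.134) The tagged toy kit has INFINITELY MANY `ℱ`-prime-strips (in print the isomorphs of `ℱ_v` form a
proper class; the untagged toy kit has exactly one, abc-iut-w5-d005's `KitsToy.subsingleton_fStrip`).
[claim: Mochizuki2012, status: disputed] -/
theorem infinite_fStrip : Infinite (FKit.toyTagged l hl).FStrip :=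
  Infinite.of_injective _ (fStrip_injective l hl)

/-- **IUTchI:Def5.2(i)** (kurims p.134) At the one place the model `ℱ_v = loc` has infinitely many isomorphs `(p, loc)` in the tagged
ambient category. [claim: Mochizuki2012, status: disputed] -/
theorem infinite_isomorphs (v : (toyKit l hl).V) :
    Infinite {Y : (FKit.toyTagged l hl).FAmb v // Nonempty (Y ≅ (FKit.toyTagged l hl).fModel v)} :=
  Infinite.of_injective
    (fun p : ℤ × ℤ =>
      (⟨((p, Model.Obj.loc) : TaggedObj l), ⟨InducedCategory.isoMk (Iso.refl _)⟩⟩ :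
        {Y : (FKit.toyTagged l hl).FAmb v // Nonempty (Y ≅ (FKit.toyTagged l hl).fModel v)}))
    fun p q h => by simpa using congrArg (fun Y : {Y : (FKit.toyTagged l hl).FAmb v //
      Nonempty (Y ≅ (FKit.toyTagged l hl).fModel v)} => (Y.1 : (ℤ × ℤ) × Model.Obj l).1) h

/-! ### 2. [IUTchIII] Prop 1.2 (x): a Frobenius-picture chain EXISTS at the tagged toy frame -/

/-- **IUTchIII:Prop1.2(x)** (kurims p.34) **POSITIVE DECISION at the tagged toy frame**: `KitsTaggedToy.frame l hl = StripFrame.ofKits …` over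
the tagged toy kit CARRIES a Frobenius-picture chain `{ⁿ𝔉}_{n∈ℤ}` of DISTINCT `ℱ`-prime-strips (abc-iut-w5-d005's criterion, decided by
`infinite_fStrip`) — the first `StripFrame.ofKits` instance in the tree that does (contrast `KitsToy.isEmpty_frobeniusChain`).
[claim: Mochizuki2012, status: disputed] -/
theorem nonempty_frobeniusChain :
    Nonempty (FrobeniusChain (Literature.IUT.LogThetaLattice.KitsTaggedToy.frame l hl)) :=
  (FrobeniusChain.nonempty_ofKits_iff _ _ _ _ _).2 (infinite_fStrip l hl)

/-- **IUTchIII:Prop1.2(x)** (kurims p.34) … with Prop 1.2 (x)'s data INSTANTIATED: along such a chain the full log-links of the tagged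
log-strip data (`KitsTaggedToy.logStripData`, `log := 𝟭`) induce the FULL `𝒟`-poly-isomorphisms, and any two members have isomorphic
`𝒟`-prime-strips (abc-iut-w5-d005's `FrobeniusChain.link_instantiated_ofKits_of_place` at the one place).
[claim: Mochizuki2012, status: disputed] -/
theorem frobeniusChain_link_instantiated (v : (toyKit l hl).V) :
    ∃ P : FrobeniusChain (Literature.IUT.LogThetaLattice.KitsTaggedToy.frame l hl),
      (∀ n : ℤ, (P.link (Literature.IUT.LogThetaLattice.KitsTaggedToy.logStripData l hl) n).inducedD = PolyIso.full _ _) ∧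
        ∀ n m : ℤ, Nonempty ((Literature.IUT.LogThetaLattice.KitsTaggedToy.frame l hl).toD.obj (P.F n) ≅
          (Literature.IUT.LogThetaLattice.KitsTaggedToy.frame l hl).toD.obj (P.F m)) :=
  FrobeniusChain.link_instantiated_ofKits_of_place _ _ _ _ _ (logKit l hl) v (infinite_isomorphs l hl v)

/-- **IUTchIII:Prop1.2(x)** (kurims p.34) The two kit frames of the tree DIFFER on Prop 1.2 (x): empty at the toy frame, inhabited at the
tagged toy frame — the clause is exactly «infinitely many isomorphs of `ℱ_v`». [claim: Mochizuki2012, status: disputed] -/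
theorem frobeniusChain_toy_vs_tagged :
    IsEmpty (FrobeniusChain (KitsToy.frame l hl)) ∧
      Nonempty (FrobeniusChain (Literature.IUT.LogThetaLattice.KitsTaggedToy.frame l hl)) :=
  ⟨KitsToy.isEmpty_frobeniusChain l hl, nonempty_frobeniusChain l hl⟩

/-- **IUTchIII:Def1.4** (kurims p.45) At the tagged toy frame BOTH a log-theta-lattice of DISTINCT Hodge theaters (Def 1.4, this seat's
`KitsTaggedToy.latticeDiagram`) and a Frobenius-picture chain of DISTINCT `ℱ`-prime-strips (Prop 1.2 (x)) EXIST.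
[claim: Mochizuki2012, status: disputed] -/
theorem lattice_and_frobeniusChain (kind : LatticeKind) :
    Nonempty (LogThetaLatticeDiagram (Literature.IUT.LogThetaLattice.KitsTaggedToy.logStripData l hl)
        (Literature.IUT.LogThetaLattice.KitsTaggedToy.thetaLinkData l hl)) ∧
      Nonempty (FrobeniusChain (Literature.IUT.LogThetaLattice.KitsTaggedToy.frame l hl)) :=
  ⟨nonempty_latticeDiagram l hl kind, nonempty_frobeniusChain l hl⟩

end KitsTaggedToy

end Literature.IUT.LogThetaLattice
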